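import Mathlib
import Literature.Geometry.Symplectic.StandardEnd
import Literature.Geometry.Symplectic.GromovR4RelEnd
import Literature.Geometry.Symplectic.GromovMcDuffTwistedSphereProofs
import Literature.Topology.FourManifolds.HomotopySpheres
import Literature.Topology.FourManifolds.HomotopyS4CompactProofs
import Literature.Topology.FourManifolds.HomotopyS4OrientableProofs
import Summits.SmoothPoincare4.SmoothPoincare4.Theorems.PICReduction
import Summits.SmoothPoincare4.SmoothPoincare4.Theses.SymplecticOrigami

/-!
# Sketch — crux idea `last-circle-death` for crux `OrigamiFoldExistence`
(item stmt-SmoothPoincare4-7844, route SymplecticOrigami; crux-ideate round 1, ideator k = 1, gen 2)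

First lemmas of the line "let Taubes' last zero-circle die inside the fake ball":

* `IsStandardEndOneCircle p ε sf c` — on the punctured homotopy sphere `Σ ∖ {p}`, `sf` is a smooth
  closed 2-form which is STANDARD AT INFINITY in the chart at `p` (verbatim the end clause of
  `Literature.Geometry.Symplectic.IsSymplecticStandardNearPoint`), vanishes identically along the
  image of a smoothly embedded circle `c`, and is pointwise nondegenerate off that image
  (informally: near-symplectic with zero set exactly one — necessarily twisted — circle; the
  transverse-vanishing clause is left informal, the tree has no jet API for `MForm`).
* `RoundEndOneCircle` — FIRST LEMMA (existence of the starting datum; in print: Gerig AGT 21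
  (2021) Thm 1.6 = Taubes MRL 13 (2006) §2 assertion, L²-Hodge theory on the cylindrical-end
  completion + Honda transversality + Luttinger–Perutz circle surgery down to one circle).
* `LastCircleDeath` — the CRUX of the line (Taubes' cancellation problem, disc version = Gerig's
  Question 1): the lone circle can be removed keeping the end standard.
* `nonempty_diffeomorph_sphere_of` / `smoothPoincare4_of` — PROVED compositions with the tree's
  Cerf-free recognition `nonempty_diffeomorph_sphere_of_recognitionR4_relEnd` (under the named fact
  `gromov_recognitionR4_relEnd`, = route SymplecticCap's crux GromovRecognitionRelEnd).
* `FoldDataTransport` — support-level bookkeeping turning "every homotopy 4-sphere is standard" plus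
  the route's support item `RoundSphereIsOrigamiFold` into the crux `OrigamiFoldExistence`, and
  `origamiFoldExistence_of` — the composition concluding the crux BY NAME.
-/

noncomputable section

open scoped Manifold ContDiff ContinuousMap
open Literature.Geometry.Symplectic Literature.Geometry.Kaehler Literature.Topology.FourManifolds

namespace Summit.SmoothPoincare4.SmoothPoincare4.Cruxes.OrigamiFoldExistence.LastCircleDeath

local notation "E4" => EuclideanSpace ℝ (Fin 4)
local notation "𝕊¹" => Metric.sphere (0 : EuclideanSpace ℝ (Fin 2)) 1
local notation "𝕊⁴" => Metric.sphere (0 : EuclideanSpace ℝ (Fin 5)) 1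

section Predicate

variable {M : Type*} [TopologicalSpace M] [ChartedSpace E4 M] [T1Space M] [IsManifold (𝓡 4) ∞ M]

/-- **Near-symplectic with one zero-circle, standard at infinity.** `0 < ε`; `sf` is a smooth closed
`2`-form on `M ∖ {p}`; `c : S¹ → M ∖ {p}` is a smooth embedding; `sf` vanishes identically along
`range c` and is pointwise nondegenerate off `range c`; and on the punctured chart-ball of radius
`ε` about `p` it equals the inverted standard form (the end clause of
`IsSymplecticStandardNearPoint`, verbatim). -/
def IsStandardEndOneCircle (p : M) (ε : ℝ) (sf : MForm (𝓡 4) (punctured p) ℝ 2)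
    (c : 𝕊¹ → punctured p) : Prop :=
  0 < ε ∧ IsSmoothForm sf ∧ IsClosedForm sf ∧
  Manifold.IsSmoothEmbedding (𝓡 1) (𝓡 4) ∞ c ∧
  (∀ x : punctured p, x ∉ Set.range c → ∀ v : TangentSpace (𝓡 4) x, v ≠ 0 → ∃ w, sf x ![v, w] ≠ 0) ∧
  (∀ x : punctured p, x ∈ Set.range c → ∀ v w : TangentSpace (𝓡 4) x, sf x ![v, w] = 0) ∧
  ∀ (x : punctured p), x.1 ∈ (chartAt E4 p).source →
    extChartAt (𝓡 4) p x.1 ∈ Metric.ball (extChartAt (𝓡 4) p p) ε → ∀ v w,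
      sf x ![v, w] = invertedStdForm (extChartAt (𝓡 4) p x.1 - extChartAt (𝓡 4) p p)
        (mfderiv (𝓡 4) 𝓘(ℝ, E4) (fun z : punctured p => extChartAt (𝓡 4) p z.1) x v)
        (mfderiv (𝓡 4) 𝓘(ℝ, E4) (fun z : punctured p => extChartAt (𝓡 4) p z.1) x w)

end Predicate

/-- **FIRST LEMMA (`RoundEndOneCircle`).** Every punctured homotopy 4-sphere `Σ ∖ {p}` carries a
smooth closed 2-form, standard at infinity in the chart at `p`, which is symplectic off exactly one
smoothly embedded circle along which it vanishes. (Gerig 2021 Thm 1.6: asymptotically standard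
near-symplectic forms exist on `X*`; Luttinger–Taubes–Perutz: the zero set can be surgered to any
positive number of circles; parity (Gompf–Perutz Thm 1.8) makes the lone circle twisted.) -/
def RoundEndOneCircle : Prop :=
  ∀ (S : HomotopySphere 4) (p : S.carrier),
    ∃ (ε : ℝ) (sf : MForm (𝓡 4) (punctured p) ℝ 2) (c : 𝕊¹ → punctured p),
      IsStandardEndOneCircle p ε sf c

/-- **THE CRUX OF THE LINE (`LastCircleDeath`).** On a punctured homotopy 4-sphere, a closed 2-form
standard at infinity and symplectic off one embedded circle can be MODIFIED INSIDE A SMOOTHLY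
EMBEDDED 4-BALL CONTAINING THE CIRCLE (and left unchanged off that ball) to a form that is standard
at infinity and symplectic EVERYWHERE — Taubes' cancellation problem for the last (twisted)
zero-circle, disc version (Gerig 2021 Question 1 / Example 1.7: in Luttinger's birth model the
dying twisted circle bounds an `i`-holomorphic disc, and the death happens inside a ball around it).
Intended mechanism: Taubes GT 3 (1999) Thm 1.1 on the closed-up homotopy projective plane
`ℂP² # Σ` (SW ≠ 0 in the ω-chamber) gives a finite-energy pseudo-holomorphic subvariety bounding
the circle; show it is the Luttinger disc (its regular neighbourhood with the circle is the ball
`k(B⁴)`) and run the birth model backwards inside that ball. For `Σ = S⁴` the statement is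
trivially true (take the ball to contain the whole non-standard region); for an exotic `Σ` it is
false (zero slack, as the crux). -/
def LastCircleDeath : Prop :=
  ∀ (S : HomotopySphere 4) (p : S.carrier) (ε : ℝ) (sf : MForm (𝓡 4) (punctured p) ℝ 2)
    (c : 𝕊¹ → punctured p), IsStandardEndOneCircle p ε sf c →
      ∃ (ε' : ℝ) (sf' : MForm (𝓡 4) (punctured p) ℝ 2) (k : E4 → punctured p),
        IsSymplecticStandardNearPoint p ε' sf' ∧
        Manifold.IsSmoothEmbedding (𝓡 4) (𝓡 4) ∞ k ∧
        Set.range c ⊆ k '' Metric.ball (0 : E4) 1 ∧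
        ∀ x : punctured p, x ∉ k '' Metric.closedBall (0 : E4) 1 →
          ∀ v w : TangentSpace (𝓡 4) x, sf' x ![v, w] = sf x ![v, w]

/-- A point of the round `S⁴`. -/
def northPole : 𝕊⁴ :=
  ⟨EuclideanSpace.single 0 1, by simp⟩

/-- **Rung of the line (PROVED modulo the named fact).** Under Gromov's recognition of `(ℝ⁴, ω₀)`
relative to the end (tree fact `gromov_recognitionR4_relEnd` = route SymplecticCap's crux
`GromovRecognitionRelEnd`), `RoundEndOneCircle` and `LastCircleDeath` make every homotopy
4-sphere diffeomorphic to `S⁴` (Cerf-free: `nonempty_diffeomorph_sphere_of_recognitionR4_relEnd`). -/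
theorem nonempty_diffeomorph_sphere_of (hA : gromov_recognitionR4_relEnd)
    (h₁ : RoundEndOneCircle) (h₂ : LastCircleDeath) (S : HomotopySphere 4) :
    Nonempty (S.carrier ≃ₘ⟮𝓡 4, 𝓡 4⟯ 𝕊⁴) := by
  obtain ⟨e⟩ := S.nonempty_homotopyEquiv
  let p : S.carrier := e.invFun northPole
  obtain ⟨ε, sf, c, h⟩ := h₁ S p
  obtain ⟨ε', sf', _k, h', -, -, -⟩ := h₂ S p ε sf c h
  exact nonempty_diffeomorph_sphere_of_recognitionR4_relEnd hA S p ε' sf' h'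

/-- … hence SPC4 (packaging facts `compactSpace_of_homotopyEquiv_sphere_four_holds`,
`isOrientable_of_homotopyEquiv_sphere_four_holds`, reduction `smoothPoincare4_of_forall_homotopySphere`,
all proved in tree). -/
theorem smoothPoincare4_of (hA : gromov_recognitionR4_relEnd)
    (h₁ : RoundEndOneCircle) (h₂ : LastCircleDeath) : _root_.SmoothPoincare4 :=
  Literature.SPC4.smoothPoincare4_of_forall_homotopySphere
    (fun M _ _ _ _ _ e => compactSpace_of_homotopyEquiv_sphere_four_holds M e)
    (fun M _ _ _ _ _ e => isOrientable_of_homotopyEquiv_sphere_four_holds M e)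
    (fun S => nonempty_diffeomorph_sphere_of hA h₁ h₂ S)

/-- **Transport of fold data (support-level bookkeeping).** If every smooth homotopy 4-sphere is
diffeomorphic to the round `S⁴` and the round `S⁴` carries the typed fold data (route support item
`RoundSphereIsOrigamiFold`, CdGP Ex. 2.3/2.6), then every homotopy 4-sphere carries fold data:
push `V i`, `β i` along the diffeomorphism, keep `N i`, `s i`, `S i`, `b i`. -/
def FoldDataTransport : Prop :=
  (∀ (M : Type) [TopologicalSpace M] [T2Space M] [SecondCountableTopology M]
      [ChartedSpace (EuclideanSpace ℝ (Fin 4)) M] [IsManifold (𝓡 4) ∞ M],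
      M ≃ₕ 𝕊⁴ → Nonempty (M ≃ₘ⟮𝓡 4, 𝓡 4⟯ 𝕊⁴)) →
    Theses.SymplecticOrigami.RoundSphereIsOrigamiFold →
      Theses.SymplecticOrigami.OrigamiFoldExistence

/-- **The line concludes the crux by name**: transport + round-sphere fold + Gromov recognition +
the two statements of this line ⟹ `OrigamiFoldExistence`. -/
theorem origamiFoldExistence_of (hT : FoldDataTransport)
    (hR : Theses.SymplecticOrigami.RoundSphereIsOrigamiFold) (hA : gromov_recognitionR4_relEnd)
    (h₁ : RoundEndOneCircle) (h₂ : LastCircleDeath) :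
    Theses.SymplecticOrigami.OrigamiFoldExistence := by
  refine hT (fun M _ _ _ _ _ e => ?_) hR
  haveI : CompactSpace M := compactSpace_of_homotopyEquiv_sphere_four_holds M e
  obtain ⟨o⟩ := isOrientable_of_homotopyEquiv_sphere_four_holds M e
  exact nonempty_diffeomorph_sphere_of hA h₁ h₂ ⟨M, o, ⟨e⟩⟩

end Summit.SmoothPoincare4.SmoothPoincare4.Cruxes.OrigamiFoldExistence.LastCircleDeath

end
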